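import Summits.Ventures.PercRepro.GenQPairChoose

/-!
# PercRepro — the singleton and pair shares at `q = 7` (night-4, gen 3; sheet §49)

The per-element bounds of the two charging layers at level `7` (`Φ = 9/8`): a singleton `B₀ ∪ {x}` charges at least
`(7/6 − (9/8)·dem)/3` when `#C_x = 3` and `(7/5 − (9/8)·dem)/4` otherwise; a pair `B₀ ∪ {x, y}` with
`u = #(C_x ∪ C_y) ∈ [5, 9]` has `m ≤ 9 − u` and `nb ≤ C(u, 2)`, hence charges at least `1/9 − (1/9 − 11/400)·dem`,
and at least `1/9 − (1/9 − 1/24)·dem` when `u ≥ 6` — in particular when the traces `C_x ∖ x`, `C_y ∖ y` are disjoint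
(`card_union_fc_of_disjoint_traces`).
-/

namespace PercRepro.GenQ

open Finset ThmH PerFlat SixFour ThmN

variable {α : Type*} [DecidableEq α] {M : Matroid α} [M.Finite]

/-! ## The two layers at `q = 7` -/

/-- The share from `B₀ ∪ {x}` at `q = 7` with `#C_x = 3`: at least `(7/6 − (9/8)·dem)/3`. -/
theorem single_share_seven_of_three (hs : Simple M) {G B₀ : Finset α} (hG : G ⊆ gr M)
    (hrG : M.eRk (G : Set α) = ((7 : ℕ) : ℕ∞)) (hB : B₀ ∈ basesOf M G 7) {x : α} (hx : x ∈ G) (hxB : x ∉ B₀)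
    (hcx : (fc M x B₀).card = 3) :
    (7 / 6 - 9 / 8 * dem M G 2 (insert x B₀)) / 3 ≤ wTwo M G (insert x B₀) 7 / nb M G (insert x B₀) 7 := by
  have h := single_share_ge hs hG hrG hB (by norm_num) hx hxB
  rw [hcx] at h
  norm_num at h
  linarith

/-- The share from `B₀ ∪ {x}` at `q = 7` with `#C_x ≥ 4`: at least `(7/5 − (9/8)·dem)/4`. -/
theorem single_share_seven_of_ge_four (hs : Simple M) {G B₀ : Finset α} (hG : G ⊆ gr M)
    (hrG : M.eRk (G : Set α) = ((7 : ℕ) : ℕ∞)) (hB : B₀ ∈ basesOf M G 7) {x : α} (hx : x ∈ G) (hxB : x ∉ B₀)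
    (hcx : 4 ≤ (fc M x B₀).card) :
    (7 / 5 - 9 / 8 * dem M G 2 (insert x B₀)) / 4 ≤ wTwo M G (insert x B₀) 7 / nb M G (insert x B₀) 7 := by
  have h := single_share_ge hs hG hrG hB (by norm_num) hx hxB
  have hc8 : (fc M x B₀).card ≤ 8 := by
    have := card_fc_le (M := M) x B₀
    rw [(mem_basesOf.1 hB).2.2] at this
    omega
  have hd0 := dem_nonneg (M := M) G (insert x B₀) 2
  rcases (show (fc M x B₀).card = 4 ∨ (fc M x B₀).card = 5 ∨ (fc M x B₀).card = 6 ∨ (fc M x B₀).card = 7 ∨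
      (fc M x B₀).card = 8 by omega) with h4 | h5 | h6 | h7 | h8
  · rw [h4] at h
    norm_num at h
    linarith
  · rw [h5] at h
    norm_num at h
    linarith
  · rw [h6] at h
    norm_num at h
    linarith
  · rw [h7] at h
    norm_num at h
    linarith
  · rw [h8] at h
    norm_num at h
    linarith

/-- **The pair bound at `q = 7` from a lower bound `u₀ ∈ {5, 6}` on `u = #(C_x ∪ C_y)`**: the share is at least
`1/9 − (1/9 − τ₁)·dem` with `τ₁ = 11/400` (`u₀ = 5`) or `1/24` (`u₀ = 6`). -/
theorem pair_share_seven_ge_aux (hs : Simple M) {G B₀ : Finset α} (hG : G ⊆ gr M)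
    (hrG : M.eRk (G : Set α) = ((7 : ℕ) : ℕ∞)) (hB : B₀ ∈ basesOf M G 7) {x y : α} (hx : x ∈ G) (hxB : x ∉ B₀)
    (hy : y ∈ G) (hyB : y ∉ B₀) (hxy : x ≠ y) (hU : 5 ≤ (fc M x B₀ ∪ fc M y B₀).card) :
    (1 / 9 - (1 / 9 - 11 / 400) * dem M G 2 (insert x (insert y B₀)) ≤
      wTwo M G (insert x (insert y B₀)) 7 / nb M G (insert x (insert y B₀)) 7) ∧
    (6 ≤ (fc M x B₀ ∪ fc M y B₀).card → 1 / 9 - (1 / 9 - 1 / 24) * dem M G 2 (insert x (insert y B₀)) ≤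
      wTwo M G (insert x (insert y B₀)) 7 / nb M G (insert x (insert y B₀)) 7) := by
  set S := insert x (insert y B₀) with hSdef
  obtain ⟨hBG, hr, hc⟩ := mem_basesOf.1 hB
  have hR : S ∈ Rq M G 7 := pair_mem_Rq hrG hB hx hy
  have hxS : x ∉ insert y B₀ := fun h' => by
    rcases Finset.mem_insert.1 h' with h'' | h''
    · exact hxy h''
    · exact hxB h''
  have hcardS : S.card = 9 := by
    rw [hSdef, Finset.card_insert_of_notMem hxS, Finset.card_insert_of_notMem hyB, hc]
  have hw0 : 0 ≤ wTwo M G S 7 := wTwo_nonneg_of_card_ne hs hG (by norm_num) hR (by rw [hcardS]; norm_num)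
  have hnb1 := one_le_nb hR
  have hU9 : (fc M x B₀ ∪ fc M y B₀).card ≤ 9 := by
    have : fc M x B₀ ∪ fc M y B₀ ⊆ S := Finset.union_subset
      ((fc_subset_insert x B₀).trans (Finset.insert_subset_insert x (Finset.subset_insert y B₀)))
      ((fc_subset_insert y B₀).trans (Finset.subset_insert x _))
    have := Finset.card_le_card this
    omega
  have hm := mTr_pair_le hG hrG hB hx hxB hy hyB hxy
  have hnb := nb_pair_le_choose hG hrG hB hx hxB hy hyB hxy
  rw [← hSdef] at hm hnb
  have hnbpos : (0 : ℚ) < nb M G S 7 := by exact_mod_cast (by omega : 0 < nb M G S 7)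
  have hdem0 := dem_nonneg (M := M) G S 2
  have hdem1 := dem_le_one (M := M) G S 2
  have hwTwo : wTwo M G S 7 = 7 * (1 / (1 + (mTr M S : ℚ))) - 9 / 8 * dem M G 2 S := by
    unfold wTwo wInf
    push_cast
    ring
  have branch : ∀ (n m : ℕ) (w : ℚ), 0 < n → nb M G S 7 ≤ n → mTr M S ≤ m →
      w ≤ 7 * (1 / (1 + (m : ℚ))) - 9 / 8 * dem M G 2 S → w / n ≤ wTwo M G S 7 / nb M G S 7 := by
    intro n m w hn hnb' hm' hw
    have hm'' : (mTr M S : ℚ) ≤ m := by exact_mod_cast hm'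
    have hwinf : 1 / (1 + (m : ℚ)) ≤ 1 / (1 + (mTr M S : ℚ)) :=
      one_div_le_one_div_of_le (by positivity) (by linarith)
    have hw' : w ≤ wTwo M G S 7 := by
      rw [hwTwo]
      linarith
    have hn' : (nb M G S 7 : ℚ) ≤ n := by exact_mod_cast hnb'
    calc w / n ≤ wTwo M G S 7 / n := div_le_div_of_nonneg_right hw' (Nat.cast_nonneg n)
      _ ≤ wTwo M G S 7 / nb M G S 7 := div_le_div_of_nonneg_left hw0 hnbpos hn'
  -- the five cases `u = 5 … 9`
  have h5 : (fc M x B₀ ∪ fc M y B₀).card = 5 → (7 / 5 - 9 / 8 * dem M G 2 S) / (10 : ℕ) ≤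
      wTwo M G S 7 / nb M G S 7 := fun h => branch 10 4 _ (by norm_num)
    (hnb.trans (by rw [h]; decide)) (by omega) (by norm_num)
  have h6 : (fc M x B₀ ∪ fc M y B₀).card = 6 → (7 / 4 - 9 / 8 * dem M G 2 S) / (15 : ℕ) ≤
      wTwo M G S 7 / nb M G S 7 := fun h => branch 15 3 _ (by norm_num)
    (hnb.trans (by rw [h]; decide)) (by omega) (by norm_num)
  have h7 : (fc M x B₀ ∪ fc M y B₀).card = 7 → (7 / 3 - 9 / 8 * dem M G 2 S) / (21 : ℕ) ≤
      wTwo M G S 7 / nb M G S 7 := fun h => branch 21 2 _ (by norm_num)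
    (hnb.trans (by rw [h]; decide)) (by omega) (by norm_num)
  have h8 : (fc M x B₀ ∪ fc M y B₀).card = 8 → (7 / 2 - 9 / 8 * dem M G 2 S) / (28 : ℕ) ≤
      wTwo M G S 7 / nb M G S 7 := fun h => branch 28 1 _ (by norm_num)
    (hnb.trans (by rw [h]; decide)) (by omega) (by norm_num)
  have h9 : (fc M x B₀ ∪ fc M y B₀).card = 9 → (7 - 9 / 8 * dem M G 2 S) / (36 : ℕ) ≤
      wTwo M G S 7 / nb M G S 7 := fun h => branch 36 0 _ (by norm_num)
    (hnb.trans (by rw [h]; decide)) (by omega) (by norm_num)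
  constructor
  · rcases (show (fc M x B₀ ∪ fc M y B₀).card = 5 ∨ (fc M x B₀ ∪ fc M y B₀).card = 6 ∨
        (fc M x B₀ ∪ fc M y B₀).card = 7 ∨ (fc M x B₀ ∪ fc M y B₀).card = 8 ∨
        (fc M x B₀ ∪ fc M y B₀).card = 9 by omega) with h | h | h | h | h
    · refine le_trans ?_ (h5 h)
      push_cast
      linarith
    · refine le_trans ?_ (h6 h)
      push_cast
      linarith
    · refine le_trans ?_ (h7 h)
      push_cast
      linarith
    · refine le_trans ?_ (h8 h)
      push_cast
      linarith
    · refine le_trans ?_ (h9 h)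
      push_cast
      linarith
  · intro hU6
    rcases (show (fc M x B₀ ∪ fc M y B₀).card = 6 ∨ (fc M x B₀ ∪ fc M y B₀).card = 7 ∨
        (fc M x B₀ ∪ fc M y B₀).card = 8 ∨ (fc M x B₀ ∪ fc M y B₀).card = 9 by omega) with h | h | h | h
    · refine le_trans ?_ (h6 h)
      push_cast
      linarith
    · refine le_trans ?_ (h7 h)
      push_cast
      linarith
    · refine le_trans ?_ (h8 h)
      push_cast
      linarith
    · refine le_trans ?_ (h9 h)
      push_cast
      linarith

end PercRepro.GenQ
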